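import Summits.NavierStokesRegularity.NavierStokesRegularity.Theorems.ExtremiserTransienceTwoThirdsScaleAssembly
import HarnessLib

/-!
# Route `ExtremiserTransience`, crux `NearExtremalTransiencePerFlow` (stmt-NavierStokesRegularity-26567),
# LINE g10-1 «two_thirds» (ns-idea-10), stub S1a′ — BRICK 3b COMPLETE (per scale): thick-uncovered enstrophy from the AVERAGED EXCESS

`--supports stmt-NavierStokesRegularity-26567` (helper; prover seat ns-net-p2 g12; design = evidence #59 on ⟨26567⟩).  Normalised units
(`M = λ = 1`).  Fix a scale `s > 0`, a tolerance `δ ∈ (0, 1/2]`, a thickness `θ₀`, the cubic basis `b` of spacing `4s` (`exists_cellBasis`,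
p725193) with cell cube `Q` and lattice `Λ`, and an EXCESS MAJORANT `E : ℝ³ → [0, ∞]` of the packing translates: for every translate `τ ∈ Q`
with `E τ < ∞` and every finite family `F` of THICK cells `B(c, s)`, `c ∈ Λ + τ`, the excess of the family plus its remainder is
`≤ (E τ).toReal` (this is what brick 2 delivers), and `∫_Q E ≤ e₀ · vol Q`.  THEN (`thickUncovered_le_of_excess`)
`∫_{Θ ∩ U} |curl w|² ≤ 4096 · ((ε/κ⋆)(18/δ² + 2/δ) Z + ((18/δ² + 2/δ)/κ⋆) e₀ + δ⁻¹ (Z + W) ((s + s^{7/8})³ − s³)/(8 s³))`,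
where `Θ = {θ₀ ≤ |curl w|}` and `U = {y : no δ-good ball B(c, s) has dist(c, y) < s/2}` — exactly the per-scale input `hU` of
`normalised_conclusion_of_uncovered_small` (p726887).  Proof: `badWeight_translate_le` (p728573) per translate, integrate over `Q`
(`setLIntegral_tsum_lattice_layer_eq` p727991 for the layer term, `vol B(·, 2s) ≤ vol Q`), then `thickUncovered_le_of_lattice_average` (p726775).
HONEST FRAMING: bookkeeping; nothing about Navier–Stokes is proved; no summit is proved by a line. [folklore]
-/

noncomputable section

open scoped Topology InnerProductSpace RealInnerProductSpace ENNReal NNReal ContDiff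
open MeasureTheory Filter Set Metric Function
open Literature.Analysis Literature.Analysis.FluidPDE
open Summit.NavierStokesRegularity.NavierStokesRegularity.Theorems.DepletionLadder
open Summit.NavierStokesRegularity.NavierStokesRegularity.Theorems.DepletionLadder.KStar.HalfSpace
open Summit.NavierStokesRegularity.NavierStokesRegularity.Theorems.DepletionLadder.KStar.BangBang
open Summit.NavierStokesRegularity.NavierStokesRegularity.Theorems.NearExtremalTransiencePerFlow.LocalMaximiser

namespace Summit.NavierStokesRegularity.NavierStokesRegularity.Theorems.NearExtremalTransiencePerFlow.TwoThirds

-- the problem directory repeats the summit name (`NavierStokesRegularity/NavierStokesRegularity`)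
set_option linter.dupNamespace false
set_option linter.style.longLine false

/-- The layer weight of one translate is measurable in the translate. -/
theorem measurable_tsum_layer (μ : Measure E3) [SFinite μ] (b : Module.Basis (Fin 3) ℝ E3) (s s' : ℝ) :
    Measurable fun τ : E3 => ∑' g : (Submodule.span ℤ (Set.range b)).toAddSubgroup,
      (μ (Metric.ball ((g : E3) + τ) s') - μ (Metric.ball ((g : E3) + τ) s)) := by
  haveI : Countable (Submodule.span ℤ (Set.range b)).toAddSubgroup :=
    inferInstanceAs (Countable (Submodule.span ℤ (Set.range b)))
  have h : ∀ g : (Submodule.span ℤ (Set.range b)).toAddSubgroup,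
      Measurable fun τ : E3 => μ (Metric.ball ((g : E3) + τ) s') - μ (Metric.ball ((g : E3) + τ) s) := fun g =>
    ((measurable_measure_ball μ s').comp (measurable_const_add (g : E3))).sub
      ((measurable_measure_ball μ s).comp (measurable_const_add (g : E3)))
  simp_rw [ENNReal.tsum_eq_iSup_sum]
  exact Measurable.iSup fun T => Finset.measurable_fun_sum T fun g _ => h g

/-- The cell cube `{x | ∀ j, x j ∈ [0, 4s)}` contains the ball `B((2s,2s,2s), 2s)`, so `vol B(0, 2s) ≤ vol(cube)`. -/
theorem volume_ball_two_mul_le_cellCube {s : ℝ} :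
    volume (Metric.ball (0 : E3) (2 * s)) ≤ volume {x : E3 | ∀ j, x j ∈ Set.Ico 0 (4 * s)} := by
  set ctr : E3 := WithLp.toLp 2 (fun _ : Fin 3 => 2 * s) with hctr
  rw [← Measure.addHaar_ball_center volume ctr]
  refine measure_mono fun x hx => ?_
  rw [Metric.mem_ball] at hx
  intro j
  have hj : dist (x j) (ctr j) ≤ dist x ctr := PiLp.dist_apply_le x ctr j
  have hcj : ctr j = 2 * s := by simp [hctr]
  rw [hcj, Real.dist_eq] at hj
  have h := abs_lt.1 (hj.trans_lt hx)
  exact ⟨by linarith [h.1], by linarith [h.2]⟩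

/-- **Brick 3b complete (per scale) — thick-uncovered enstrophy from the averaged excess majorant.**  See the module docstring. [folklore] -/
theorem thickUncovered_le_of_excess {A : ℕ → ℝ} {w : E3 → E3} {B ε : ℝ} (hadm : IsAdm w 1 B) (hreg : IsReg A w 1)
    (hZ : 0 < Zen w) (hW : 0 < Wpa w) (hlam : lam w = 1) (hε : 0 ≤ ε)
    (hext : (kStar - ε) * Real.sqrt (Zen w) * Real.sqrt (Wpa w) ≤ Jst w)
    {θ₀ s δ : ℝ} (hs : 0 < s) (hδ : 0 < δ) (hδ1 : δ ≤ 1 / 2)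
    (b : Module.Basis (Fin 3) ℝ E3)
    (hbQ : ∀ x : E3, x ∈ ZSpan.fundamentalDomain b ↔ ∀ j, x j ∈ Set.Ico 0 (4 * s))
    (hbΛ : ∀ x : E3, x ∈ Submodule.span ℤ (Set.range b) ↔ ∀ j, ∃ n : ℤ, x j = 4 * s * n)
    {e₀ : ℝ} (he₀ : 0 ≤ e₀) (E : E3 → ℝ≥0∞)
    (hE : ∫⁻ τ in ZSpan.fundamentalDomain b, E τ ≤ ENNReal.ofReal e₀ * volume (ZSpan.fundamentalDomain b))
    (hEX : ∀ τ ∈ ZSpan.fundamentalDomain b, E τ ≠ ⊤ → ∀ F : Finset E3, (∀ c ∈ F, c - τ ∈ Submodule.span ℤ (Set.range b)) →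
      (∀ c ∈ F, ({x | θ₀ ≤ ‖curl w x‖} ∩ Metric.ball c (s / 2)).Nonempty) →
      (∑ c ∈ F, max (Jb w c s - kStar * Real.sqrt (Zb w c s * Wb w c s)) 0) +
        max ((∫ x in (⋃ c ∈ F, Metric.ball c s)ᶜ, sd w x) -
          kStar * Real.sqrt ((∫ x in (⋃ c ∈ F, Metric.ball c s)ᶜ, zd w x) * (∫ x in (⋃ c ∈ F, Metric.ball c s)ᶜ, wd w x))) 0 ≤
        (E τ).toReal) :
    ∫ x in {x | θ₀ ≤ ‖curl w x‖} ∩ {y | ∀ c, dist c y < s / 2 → ¬ IsGoodBall w c s δ}, ‖curl w x‖ ^ 2 ≤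
      4096 * ((ε / kStar) * (18 / δ ^ 2 + 2 / δ) * Zen w + (18 / δ ^ 2 + 2 / δ) / kStar * e₀ +
        δ⁻¹ * (Zen w + Wpa w) * (((s + s ^ (7 / 8 : ℝ)) ^ 3 - s ^ 3) / (8 * s ^ 3))) := by
  obtain ⟨hv, hdiv, hvM, hvB, h0, h1, h2⟩ := id hadm
  have hv2 : ContDiff ℝ 2 w := hv.of_le (by norm_cast)
  have hv3 : ContDiff ℝ 3 w := hv.of_le (by norm_cast)
  have izd : Integrable (zd w) := (integrable_norm_curl_sq hv2 h1).1
  have iwd : Integrable (wd w) := (integrable_frobeniusNormSq_fderiv_curl hv3 h2).1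
  have hi : Integrable (fun x => zd w x + wd w x) := izd.add iwd
  have hκ : 0 < kStar := kStar_pos
  have hb' : ∀ k : ℕ, ∃ C : ℝ, ∀ x, ‖iteratedFDeriv ℝ k w x‖ ≤ C := fun k => ⟨A k * 1 * (lam w)⁻¹ ^ k, fun x => hreg k x⟩
  set C : ℝ := 18 / δ ^ 2 + 2 / δ with hC
  have hCpos : 0 < C := by positivity
  set Q : Set E3 := ZSpan.fundamentalDomain b with hQ
  set Λ := (Submodule.span ℤ (Set.range b)).toAddSubgroup with hΛ
  set s' : ℝ := s + s ^ (7 / 8 : ℝ) with hs'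
  have hss' : s ≤ s' := by rw [hs']; linarith [Real.rpow_nonneg hs.le (7 / 8 : ℝ)]
  set Θ : Set E3 := {x | θ₀ ≤ ‖curl w x‖} with hΘ
  set μΘ : Measure E3 := (volume.restrict Θ).withDensity (fun x => ENNReal.ofReal (‖curl w x‖ ^ 2)) with hμΘ
  set μb : Measure E3 := volume.withDensity (fun x => ENNReal.ofReal (zd w x + wd w x)) with hμb
  haveI : IsFiniteMeasure μb := isFiniteMeasure_withDensity_ofReal hi.hasFiniteIntegral
  set G : Set E3 := {c : E3 | IsGoodBall w c s δ} with hG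
  have hGm : MeasurableSet G := (isClosed_setOf_isGoodBall hv hb' hs.le δ).measurableSet
  have hQm : MeasurableSet Q := ZSpan.fundamentalDomain_measurableSet b
  set a : ℝ := ε / kStar * C * Zen w with ha
  have ha0 : 0 ≤ a := by positivity
  set ℓ : ℝ := (Zen w + Wpa w) * ((s' ^ 3 - s ^ 3) / (8 * s ^ 3)) with hℓ
  have hℓ0 : 0 ≤ ℓ := by
    have : s ^ 3 ≤ s' ^ 3 := by gcongr
    rw [hℓ]; exact mul_nonneg (by linarith) (div_nonneg (by linarith) (by positivity))
  set L : E3 → ℝ≥0∞ := fun τ => ∑' g : Λ, (μb (Metric.ball ((g : E3) + τ) s') - μb (Metric.ball ((g : E3) + τ) s)) with hL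
  have hLm : Measurable L := measurable_tsum_layer μb b s s'
  -- ### per-translate bound
  have hper : ∀ τ ∈ Q, (∑' g : Λ, Gᶜ.indicator (fun c => μΘ (Metric.ball c (s / 2))) ((g : E3) + τ)) ≤
      ENNReal.ofReal a + ENNReal.ofReal (C / kStar) * E τ + ENNReal.ofReal δ⁻¹ * L τ := by
    intro τ hτ
    by_cases hEτ : E τ = ⊤
    · have htop : ENNReal.ofReal (C / kStar) * E τ = ⊤ := by
        rw [hEτ]; exact ENNReal.mul_top (ne_of_gt (ENNReal.ofReal_pos.2 (by positivity)))
      calc _ ≤ (⊤ : ℝ≥0∞) := le_top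
        _ = ENNReal.ofReal (C / kStar) * E τ := htop.symm
        _ ≤ ENNReal.ofReal a + ENNReal.ofReal (C / kStar) * E τ := le_add_self
        _ ≤ _ := le_self_add
    have h := badWeight_translate_le (A := A) (θ₀ := θ₀) hadm hZ hW hlam hext hs hδ hδ1 b hbΛ τ (e := (E τ).toReal) (hEX τ hτ hEτ)
    have hid : (ε / kStar + (E τ).toReal / (kStar * Zen w)) * C * Zen w = a + C / kStar * (E τ).toReal := by
      rw [ha]; field_simp
    have hsplit : ENNReal.ofReal ((ε / kStar + (E τ).toReal / (kStar * Zen w)) * C * Zen w) ≤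
        ENNReal.ofReal a + ENNReal.ofReal (C / kStar) * E τ := by
      rw [hid, ENNReal.ofReal_add ha0 (by positivity)]
      refine add_le_add le_rfl ?_
      rw [ENNReal.ofReal_mul (by positivity : (0 : ℝ) ≤ C / kStar)]
      gcongr
      exact ENNReal.ofReal_toReal_le
    calc _ ≤ _ := h
      _ ≤ _ := by gcongr
  -- ### integrate over the cell cube
  have hμb_univ : μb Set.univ = ENNReal.ofReal (Zen w + Wpa w) := by
    rw [hμb, withDensity_apply _ MeasurableSet.univ, Measure.restrict_univ,
      ← ofReal_integral_eq_lintegral_ofReal hi (Eventually.of_forall fun x => add_nonneg (sq_nonneg _) (frobeniusNormSq_nonneg _)),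
      integral_add izd iwd]
    rfl
  have hV1 : volume (Metric.ball (0 : E3) 1) ≠ ⊤ := measure_ball_lt_top.ne
  have hlayer_int : ∫⁻ τ in Q, L τ = ENNReal.ofReal (s' ^ 3 - s ^ 3) * volume (Metric.ball (0 : E3) 1) * ENNReal.ofReal (Zen w + Wpa w) := by
    rw [hL, hQ, hΛ, setLIntegral_tsum_lattice_layer_eq μb hss' b, hμb_univ,
      Measure.addHaar_ball_of_pos volume _ (hs.trans_le hss'), Measure.addHaar_ball_of_pos volume _ hs,
      finrank_euclideanSpace, Fintype.card_fin, ← ENNReal.sub_mul (fun _ _ => hV1), ← ENNReal.ofReal_sub _ (by positivity)]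
  have hQvol : ENNReal.ofReal (8 * s ^ 3) * volume (Metric.ball (0 : E3) 1) ≤ volume Q := by
    have hQset : Q = {x : E3 | ∀ j, x j ∈ Set.Ico 0 (4 * s)} := Set.ext hbQ
    rw [hQset, show 8 * s ^ 3 = (2 * s) ^ 3 by ring]
    have h := Measure.addHaar_ball_of_pos volume (0 : E3) (by positivity : (0 : ℝ) < 2 * s)
    rw [finrank_euclideanSpace, Fintype.card_fin] at h
    rw [← h]
    exact volume_ball_two_mul_le_cellCube
  have hd0 : 0 ≤ s' ^ 3 - s ^ 3 := by
    have : s ^ 3 ≤ s' ^ 3 := by gcongr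
    linarith
  have key : ENNReal.ofReal (s' ^ 3 - s ^ 3) * ENNReal.ofReal (Zen w + Wpa w) = ENNReal.ofReal ℓ * ENNReal.ofReal (8 * s ^ 3) := by
    rw [← ENNReal.ofReal_mul hd0, ← ENNReal.ofReal_mul hℓ0]
    congr 1
    rw [hℓ]; field_simp
  have hlayer_le : ∫⁻ τ in Q, L τ ≤ ENNReal.ofReal ℓ * volume Q := by
    rw [hlayer_int]
    calc ENNReal.ofReal (s' ^ 3 - s ^ 3) * volume (Metric.ball (0 : E3) 1) * ENNReal.ofReal (Zen w + Wpa w)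
        = ENNReal.ofReal (s' ^ 3 - s ^ 3) * ENNReal.ofReal (Zen w + Wpa w) * volume (Metric.ball (0 : E3) 1) := by ring
      _ = ENNReal.ofReal ℓ * (ENNReal.ofReal (8 * s ^ 3) * volume (Metric.ball (0 : E3) 1)) := by rw [key, mul_assoc]
      _ ≤ ENNReal.ofReal ℓ * volume Q := by gcongr
  have hint : ∫⁻ τ in Q, (∑' g : Λ, Gᶜ.indicator (fun c => μΘ (Metric.ball c (s / 2))) ((g : E3) + τ)) ≤
      ENNReal.ofReal (a + C / kStar * e₀ + δ⁻¹ * ℓ) * volume Q := by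
    calc ∫⁻ τ in Q, (∑' g : Λ, Gᶜ.indicator (fun c => μΘ (Metric.ball c (s / 2))) ((g : E3) + τ))
        ≤ ∫⁻ τ in Q, (ENNReal.ofReal a + ENNReal.ofReal (C / kStar) * E τ + ENNReal.ofReal δ⁻¹ * L τ) :=
          setLIntegral_mono' hQm fun τ hτ => hper τ hτ
      _ = (∫⁻ τ in Q, (ENNReal.ofReal a + ENNReal.ofReal (C / kStar) * E τ)) + ∫⁻ τ in Q, ENNReal.ofReal δ⁻¹ * L τ :=
          lintegral_add_right _ (hLm.const_mul _)
      _ = ((∫⁻ _τ in Q, ENNReal.ofReal a) + ∫⁻ τ in Q, ENNReal.ofReal (C / kStar) * E τ) + ∫⁻ τ in Q, ENNReal.ofReal δ⁻¹ * L τ := by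
          rw [lintegral_add_left measurable_const]
      _ ≤ ENNReal.ofReal a * volume Q + ENNReal.ofReal (C / kStar) * (ENNReal.ofReal e₀ * volume Q) +
            ENNReal.ofReal δ⁻¹ * (ENNReal.ofReal ℓ * volume Q) := by
          refine add_le_add (add_le_add (setLIntegral_const Q (ENNReal.ofReal a)).le ?_) ?_
          · rw [lintegral_const_mul' _ _ ENNReal.ofReal_ne_top]
            gcongr
          · rw [lintegral_const_mul' _ _ ENNReal.ofReal_ne_top]
            gcongr
      _ = ENNReal.ofReal (a + C / kStar * e₀ + δ⁻¹ * ℓ) * volume Q := by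
          rw [ENNReal.ofReal_add (by positivity) (by positivity), ENNReal.ofReal_add ha0 (by positivity),
            ENNReal.ofReal_mul (by positivity : (0:ℝ) ≤ C / kStar), ENNReal.ofReal_mul (inv_nonneg.2 hδ.le)]
          ring
  -- ### conclude with the translate-averaging bridge
  have hβ : 0 ≤ a + C / kStar * e₀ + δ⁻¹ * ℓ := by positivity
  have hres := thickUncovered_le_of_lattice_average (v := w) izd (Θ := Θ) hGm hs b hbQ hβ hint
  calc _ ≤ _ := hres
    _ = _ := by simp only [ha, hℓ, hC, hs']; ring

end Summit.NavierStokesRegularity.NavierStokesRegularity.Theorems.NearExtremalTransiencePerFlow.TwoThirds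

end
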